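import Literature.Algebra.EuclideanLattices.MRGapCVPWitnessLaw
import Literature.Algebra.EuclideanLattices.MRGapCVPWitnessMoments
import Literature.Algebra.EuclideanLattices.MRGapCVPVerifierAcceptance
import HarnessLib

/-!
# MR07 Thm. 5.23, NO instances: the conditional witness law satisfies (16)–(18), and the verifier accepts `N` blockwise witnesses except with small probability — proved

Topic `Algebra/EuclideanLattices` (family `pqc`). Micciancio–Regev 2007, proof of Thm. 5.23, NO case
(authors' version pp. 29–31), for the idealised run `wRun` on the fine grid of the dual lattice:

* `sum_sq_le_of_isSolution'` — an `SIS′` solution has `∑ zᵢ² ≤ β²`;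
* `tsum_cond_toReal_mul_cos_le` — **eq. (16) for the conditional witness law `D`** on a NO instance
  (`λ₁(L) > g`, `dist(kt, L) > g` for all odd `k`, `s = 2√n/g`): `E_D cos(2π⟨t, w⟩) ≤ 2·2⁻ⁿ`;
* `tsum_cond_toReal_mul_indicator_le` — **eq. (17) for `D`**: `Pr_D[√(nm)·2sβ ≤ ‖w‖] ≤ m(1+ε)/(1−ε)2⁻ⁿ`;
* `tsum_cond_mul_ofReal_inner_sq_le`, `tsum_cond_mul_enorm_sq_le` — **eq. (18) for `D`** and the
  second moment of `‖w‖`;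
* `accepts` (definition with body) — the verifier's verdict on blockwise outcomes;
* `toReal_indepLaw_cond_reject_le` — for `N` i.i.d. samples of `D` the verifier rejects with
  probability at most the Hoeffding + Lemma 5.20 bound (`MRGapCVPVerifierAcceptance`);
* `toReal_blocks_not_accepts_le` — **for `N` blocks of `k` runs of `W`**, the verdict is negative with
  probability at most `N·Pr[abort]^k +` (the same bound) (`FirstSuccessBlocks`).

## References

* D. Micciancio, O. Regev, *Worst-case to average-case reductions based on Gaussian measures*,
  SIAM J. Comput. 37 (2007) 267–302; authors' version, Thm. 5.23 and its proof, pp. 28–31.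
-/

noncomputable section

open Finset Module Submodule

namespace Literature.Algebra.EuclideanLattices

namespace MicciancioRegev2007

section Blocks

open scoped ENNReal Classical Real InnerProductSpace
open MeasureTheory ProbabilityTheory Metric PMF Literature.Probability.Distributions
  Literature.Computability.Cryptography Literature.Computability.Cryptography.SIS

variable {V : Type*} [NormedAddCommGroup V] [InnerProductSpace ℝ V] [FiniteDimensional ℝ V]
  [MeasurableSpace V] [BorelSpace V]
variable {n : ℕ} (b : Basis (Fin n) ℝ V) (q d : ℕ) [NeZero q] [NeZero d]
variable (L : Submodule ℤ V) [DiscreteTopology L] [IsZLattice ℝ L]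
variable (rep : (Fin n → ZMod (q * d)) ⧸ gridImage b (q * d) (dualLattice L) → span ℤ (Set.range b))
variable {m : ℕ}

/-- An `SIS′` solution has `∑ zᵢ² ≤ β²`. [cite: MicciancioRegev2007, Def. 5.4] -/
theorem sum_sq_le_of_isSolution' {q' : ℕ} {A : Matrix (Fin n) (Fin m) (ZMod q')} {β : ℝ}
    {z : Fin m → ℤ} (h : IsSolution' A β z) : ∑ i, (z i : ℝ) ^ 2 ≤ β ^ 2 := by
  obtain ⟨j, -⟩ := h.1
  exact (mulVec_eq_zero_and_of_isSolution h.isSolution (j₀ := j) rfl).2.1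

/-- An `SIS′` solution has a nonzero odd coordinate. [cite: MicciancioRegev2007, Def. 5.4] -/
theorem exists_odd_ne_zero_of_isSolution' {q' : ℕ} {A : Matrix (Fin n) (Fin m) (ZMod q')} {β : ℝ}
    {z : Fin m → ℤ} (h : IsSolution' A β z) : ∃ j, Odd (z j) ∧ z j ≠ 0 := by
  obtain ⟨j, hj⟩ := h.1
  refine ⟨j, hj, fun h0 => ?_⟩
  rw [h0] at hj
  have := Int.odd_iff.1 hj
  omega

/-! ### Eqs. (16)–(18) for the conditional witness law `D` -/

/-- **Eq. (16) for the conditional witness law on a NO instance** (`n ≥ 2`, `0 < g < λ₁(L)`,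
`dist(kt, L) > g` for every odd `k`, `s = 2√n/g`): `∑_w D(w) cos(2π⟨t, w⟩) ≤ 2·2⁻ⁿ`.
[cite: MicciancioRegev2007, Thm. 5.23 (proof, p. 30, eq. (16): "this is true also without
conditioning")] -/
theorem tsum_cond_toReal_mul_cos_le (hSL : ∀ j, ((q * d : ℕ) : ℝ) • b j ∈ dualLattice L)
    (hrep : ∀ a, gridClass b (q * d) (dualLattice L) (rep a) = a)
    (O : Matrix (Fin n) (Fin m) (ZMod q) → PMF (Fin m → ℤ)) (hn : 2 ≤ finrank ℝ V) {g : ℝ}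
    (hg : 0 < g) (hgL : g < minNorm L) (t : V)
    (hodd : ∀ k : ℤ, Odd k → g < infDist ((k : ℝ) • t) (L : Set V)) (β : ℝ)
    (hρ : (wRun b q d (dualLattice L) rep hSL hrep O (2 * Real.sqrt (finrank ℝ V) / g) β) none ≠ 1)
    {D : PMF (dualLattice L)}
    (hD : ∀ w, (wRun b q d (dualLattice L) rep hSL hrep O (2 * Real.sqrt (finrank ℝ V) / g) β)
      (some w) = (1 - (wRun b q d (dualLattice L) rep hSL hrep O (2 * Real.sqrt (finrank ℝ V) / g) β)
        none) * D w) :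
    ∑' w, (D w).toReal * Real.cos (2 * π * ⟪t, ((w : dualLattice L) : V)⟫_ℝ) ≤
      2 * (2⁻¹ : ℝ) ^ finrank ℝ V := by
  refine tsum_cond_toReal_mul_le b q d (dualLattice L) rep hSL hrep O _ β hρ hD
    (fun v => Real.cos (2 * π * ⟪t, v⟫_ℝ)) zero_le_one (fun v => Real.abs_cos_le_one _)
    (by positivity) ?_
  intro cbar hv z _ hsol
  obtain ⟨j, hj, hzj⟩ := exists_odd_ne_zero_of_isSolution' hsol
  have hfar : g < infDist (((-z j : ℤ) : ℝ) • t) (L : Set V) := hodd (-z j) hj.neg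
  have h := tsum_condLaw_toReal_mul_cos_output_le b q d L rep hn hg hgL cbar
    (combineOutput b q d (dualLattice L) rep cbar hv z) t hzj hfar
  simpa only [output] using h

/-- **Eq. (17) for the conditional witness law** (`0 < ε < 1`, `0 < s`, `η_ε(L*) ≤ s`, `nm ≥ 1`,
and the Lemma 5.8 (iii) bound `‖x − ∑ zᵢĉᵢ‖ < sβ` for every `SIS′`-short `z`):
`Pr_D[√(nm)·2sβ ≤ ‖w‖] ≤ m(1+ε)/(1−ε)2⁻ⁿ`. [cite: MicciancioRegev2007, Thm. 5.23 (proof, p. 31, eq. (17))] -/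
theorem tsum_cond_toReal_mul_indicator_le (hSL : ∀ j, ((q * d : ℕ) : ℝ) • b j ∈ dualLattice L)
    (hrep : ∀ a, gridClass b (q * d) (dualLattice L) (rep a) = a)
    (O : Matrix (Fin n) (Fin m) (ZMod q) → PMF (Fin m → ℤ)) {ε s β : ℝ} (hε : 0 < ε) (hε1 : ε < 1)
    (hs : 0 < s) (hηs : smoothingParameter (dualLattice L) ε ≤ s) (hnm : 1 ≤ finrank ℝ V * m)
    (hx : ∀ (cbar : Fin m → (Fin n → ZMod (q * d)) ⧸ gridImage b (q * d) (dualLattice L))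
      (hv : Fin m → (QuotientAddGroup.mk' (gridImage b (q * d) (dualLattice L))).ker) (z : Fin m → ℤ),
      ‖intVecToEuclidean m z‖ ≤ β →
      ‖combineOutput b q d (dualLattice L) rep cbar hv z - ∑ i, (z i : ℝ) • (rep (cbar i) : V)‖ <
        s * β)
    (hρ : (wRun b q d (dualLattice L) rep hSL hrep O s β) none ≠ 1) {D : PMF (dualLattice L)}
    (hD : ∀ w, (wRun b q d (dualLattice L) rep hSL hrep O s β) (some w) =
      (1 - (wRun b q d (dualLattice L) rep hSL hrep O s β) none) * D w) :
    ∑' w, (D w).toReal *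
        (if Real.sqrt (finrank ℝ V * m) * (2 * s * β) ≤ ‖((w : dualLattice L) : V)‖ then (1 : ℝ)
          else 0) ≤
      m * ((1 + ε) / (1 - ε) * (2⁻¹ : ℝ) ^ finrank ℝ V) := by
  refine tsum_cond_toReal_mul_le b q d (dualLattice L) rep hSL hrep O s β hρ hD
    (fun v => if Real.sqrt (finrank ℝ V * m) * (2 * s * β) ≤ ‖v‖ then (1 : ℝ) else 0) zero_le_one
    (fun v => by split_ifs <;> simp) (by positivity) ?_
  intro cbar hv z _ hsol
  have h := tsum_condLaw_toReal_mul_indicator_output_le b q d (dualLattice L) rep hε hε1 hs hηs cbar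
    (combineOutput b q d (dualLattice L) rep cbar hv z) (sum_sq_le_of_isSolution' hsol) hnm
    (hx cbar hv z hsol.2.2)
  simpa only [output] using h

/-- **Eq. (18) for the conditional witness law** (`2η_ε(L*) ≤ s`, side condition `≤ 1`, unit `u`, and
`‖x − ∑ zᵢĉᵢ‖ ≤ sβ` for `SIS′`-short `z`): `∑_w D(w) ⟨u, w⟩² ≤ (2sβ)²` (in `ℝ≥0∞`).
[cite: MicciancioRegev2007, Thm. 5.23 (proof, p. 31, eq. (18))] -/
theorem tsum_cond_mul_ofReal_inner_sq_le (hSL : ∀ j, ((q * d : ℕ) : ℝ) • b j ∈ dualLattice L)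
    (hrep : ∀ a, gridClass b (q * d) (dualLattice L) (rep a) = a)
    (O : Matrix (Fin n) (Fin m) (ZMod q) → PMF (Fin m → ℤ)) {ε s β : ℝ} (hε : 0 < ε) (hε1 : ε < 1)
    (hs : 0 < s) (hηs : 2 * smoothingParameter (dualLattice L) ε ≤ s)
    (hnum : 1 / (2 * π) + ε / (1 - ε) + (ε / (1 - ε)) ^ 2 * m ≤ 1)
    (hx : ∀ (cbar : Fin m → (Fin n → ZMod (q * d)) ⧸ gridImage b (q * d) (dualLattice L))
      (hv : Fin m → (QuotientAddGroup.mk' (gridImage b (q * d) (dualLattice L))).ker) (z : Fin m → ℤ),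
      ‖intVecToEuclidean m z‖ ≤ β →
      ‖combineOutput b q d (dualLattice L) rep cbar hv z - ∑ i, (z i : ℝ) • (rep (cbar i) : V)‖ ≤
        s * β)
    (hρ : (wRun b q d (dualLattice L) rep hSL hrep O s β) none ≠ 1) {D : PMF (dualLattice L)}
    (hD : ∀ w, (wRun b q d (dualLattice L) rep hSL hrep O s β) (some w) =
      (1 - (wRun b q d (dualLattice L) rep hSL hrep O s β) none) * D w) {u : V} (hu : ‖u‖ = 1) :
    ∑' w, D w * ENNReal.ofReal (⟪u, ((w : dualLattice L) : V)⟫_ℝ ^ 2) ≤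
      ENNReal.ofReal ((2 * s * β) ^ 2) := by
  refine tsum_cond_mul_le b q d (dualLattice L) rep hSL hrep O s β hρ hD
    (fun v => ENNReal.ofReal (⟪u, v⟫_ℝ ^ 2)) ?_
  intro cbar hv z _ hsol
  have h := tsum_condLaw_mul_ofReal_inner_output_sq_le b q d (dualLattice L) rep hε hε1 hs hηs cbar
    (combineOutput b q d (dualLattice L) rep cbar hv z) (sum_sq_le_of_isSolution' hsol) hnum hu
    (hx cbar hv z hsol.2.2)
  simpa only [output] using h

/-- **Second moment of `‖w‖` under the conditional witness law**: `∑_w D(w) ‖w‖² ≤ n (2sβ)²`.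
[cite: MicciancioRegev2007, Thm. 5.23 (proof, p. 31, eq. (18))] -/
theorem tsum_cond_mul_enorm_sq_le (hSL : ∀ j, ((q * d : ℕ) : ℝ) • b j ∈ dualLattice L)
    (hrep : ∀ a, gridClass b (q * d) (dualLattice L) (rep a) = a)
    (O : Matrix (Fin n) (Fin m) (ZMod q) → PMF (Fin m → ℤ)) {ε s β : ℝ} (hε : 0 < ε) (hε1 : ε < 1)
    (hs : 0 < s) (hηs : 2 * smoothingParameter (dualLattice L) ε ≤ s)
    (hnum : 1 / (2 * π) + ε / (1 - ε) + (ε / (1 - ε)) ^ 2 * m ≤ 1)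
    (hx : ∀ (cbar : Fin m → (Fin n → ZMod (q * d)) ⧸ gridImage b (q * d) (dualLattice L))
      (hv : Fin m → (QuotientAddGroup.mk' (gridImage b (q * d) (dualLattice L))).ker) (z : Fin m → ℤ),
      ‖intVecToEuclidean m z‖ ≤ β →
      ‖combineOutput b q d (dualLattice L) rep cbar hv z - ∑ i, (z i : ℝ) • (rep (cbar i) : V)‖ ≤
        s * β)
    (hρ : (wRun b q d (dualLattice L) rep hSL hrep O s β) none ≠ 1) {D : PMF (dualLattice L)}
    (hD : ∀ w, (wRun b q d (dualLattice L) rep hSL hrep O s β) (some w) =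
      (1 - (wRun b q d (dualLattice L) rep hSL hrep O s β) none) * D w) :
    ∑' w, D w * (‖((w : dualLattice L) : V)‖ₑ : ℝ≥0∞) ^ 2 ≤
      finrank ℝ V * ENNReal.ofReal ((2 * s * β) ^ 2) := by
  refine tsum_cond_mul_le b q d (dualLattice L) rep hSL hrep O s β hρ hD
    (fun v => (‖v‖ₑ : ℝ≥0∞) ^ 2) ?_
  intro cbar hv z _ hsol
  have h := tsum_condLaw_mul_enorm_output_sq_le b q d (dualLattice L) rep hε hε1 hs hηs cbar
    (combineOutput b q d (dualLattice L) rep cbar hv z) (sum_sq_le_of_isSolution' hsol) hnum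
    (hx cbar hv z hsol.2.2)
  simpa only [output] using h

/-! ### The verifier on `N` i.i.d. samples of the conditional witness law -/

/-- **The verifier rejects `N` i.i.d. samples of `D` only with small probability** when `D` satisfies
eqs. (16)–(18) with `s = 2√n/(γd)`, `γ = 14π√nβ` (Hoeffding for test (b), Lemma 5.20 for test (c):
`MRGapCVPVerifierAcceptance`), read on the product `PMF`.
[cite: MicciancioRegev2007, Thm. 5.23 (proof, NO case, pp. 30–31)] -/
theorem toReal_indepLaw_cond_reject_le (hn : 2 ≤ finrank ℝ V) (t : V) {β dd K σ₁ : ℝ} (hβ : 0 < β)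
    (hdd : 0 < dd) (hK : 0 < K) {D : PMF (dualLattice L)}
    (h16 : ∑' w, (D w).toReal * Real.cos (2 * π * ⟪t, ((w : dualLattice L) : V)⟫_ℝ) ≤
      2 * (2⁻¹ : ℝ) ^ finrank ℝ V)
    (h18 : ∀ u : V, ‖u‖ = 1 → ∑' w, D w * ENNReal.ofReal (⟪u, ((w : dualLattice L) : V)⟫_ℝ ^ 2) ≤
      ENNReal.ofReal ((2 * (2 * Real.sqrt (finrank ℝ V) /
        (14 * π * Real.sqrt (finrank ℝ V) * β * dd)) * β) ^ 2))
    (h17 : ∑' w, (D w).toReal * (if K * (2 * (2 * Real.sqrt (finrank ℝ V) /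
        (14 * π * Real.sqrt (finrank ℝ V) * β * dd)) * β) ≤ ‖((w : dualLattice L) : V)‖ then (1 : ℝ)
          else 0) ≤ σ₁)
    {C : ℝ≥0∞} (hC : C ≠ ∞) (hnorm : ∑' w, D w * (‖((w : dualLattice L) : V)‖ₑ : ℝ≥0∞) ^ 2 ≤ C)
    (N : ℕ) [NeZero N] :
    ((indepLaw N fun _ => D).toOuterMeasure
        {ω | ¬ ((∑ i, Real.cos (2 * π * ⟪t, ((ω i : dualLattice L) : V)⟫_ℝ)) / N < 1 / 2 ∧
          ∀ x : V, ∑ i, ⟪x, ((ω i : dualLattice L) : V)⟫_ℝ ^ 2 ≤ N * ‖x‖ ^ 2 / (2 * π * dd) ^ 2)}).toReal ≤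
      Real.exp (-(N * (1 / 2 - 2 * (2⁻¹ : ℝ) ^ finrank ℝ V) ^ 2 / 2)) +
        (Real.exp (-(N / K ^ 4)) * (4 * Real.sqrt (finrank ℝ V) * K ^ 2) ^ finrank ℝ V + N * σ₁) := by
  set P := (indepLaw N fun _ => D).toMeasure with hP
  set w : Fin N → (Fin N → dualLattice L) → V := fun i ω => ((ω i : dualLattice L) : V) with hw
  have hlaw : ∀ i, HasLaw (fun ω : Fin N → dualLattice L => ω i) D.toMeasure P := fun i =>
    hasLaw_eval_indepLaw N (fun _ => D) i
  have hind : iIndepFun w P :=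
    (iIndepFun_eval_indepLaw N fun _ => D).comp (fun _ (x : dualLattice L) => (x : V))
      fun _ => measurable_of_countable _
  -- lower integrals of functions of one coordinate
  have hlint : ∀ (i : Fin N) (F : dualLattice L → ℝ≥0∞),
      ∫⁻ ω, F (ω i) ∂P = ∑' x, D x * F x := fun i F => by
    rw [← lintegral_toMeasure_eq_tsum, ← (hlaw i).map_eq,
      lintegral_map (measurable_of_countable F) (measurable_pi_apply i)]
  have hL2 : ∀ i, MemLp (w i) 2 P := fun i =>
    memLp_two_toMeasure_of_lintegral_sq_le _ (measurable_of_countable _).aestronglyMeasurable hC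
      (by rw [hlint i (fun x => (‖((x : dualLattice L) : V)‖ₑ : ℝ≥0∞) ^ 2)]; exact hnorm)
  have h16' : ∀ i, ∫ ω, Real.cos (2 * π * ⟪t, w i ω⟫_ℝ) ∂P ≤ 2 * (2⁻¹ : ℝ) ^ finrank ℝ V := by
    intro i
    have h := (hlaw i).integral_comp
      (f := fun x : dualLattice L => Real.cos (2 * π * ⟪t, ((x : dualLattice L) : V)⟫_ℝ))
      (measurable_of_countable _).aestronglyMeasurable
    have hI : ∫ ω, Real.cos (2 * π * ⟪t, w i ω⟫_ℝ) ∂P =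
        ∫ x, Real.cos (2 * π * ⟪t, ((x : dualLattice L) : V)⟫_ℝ) ∂D.toMeasure := h
    rw [hI, integral_toMeasure_eq_tsum_of_abs_le D (M := 1) fun x => Real.abs_cos_le_one _]
    exact h16
  have h18' : ∀ i (u : V), ‖u‖ = 1 → ∫ ω, ⟪u, w i ω⟫_ℝ ^ 2 ∂P ≤
      (2 * (2 * Real.sqrt (finrank ℝ V) / (14 * π * Real.sqrt (finrank ℝ V) * β * dd)) * β) ^ 2 := by
    intro i u hu
    rw [integral_eq_lintegral_of_nonneg_ae (ae_of_all _ fun _ => sq_nonneg _)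
      (measurable_of_countable _).aestronglyMeasurable]
    refine ENNReal.toReal_le_of_le_ofReal (sq_nonneg _) ?_
    rw [hlint i (fun x => ENNReal.ofReal (⟪u, ((x : dualLattice L) : V)⟫_ℝ ^ 2))]
    exact h18 u hu
  have h17' : ∀ i, P.real {ω | K * (2 * (2 * Real.sqrt (finrank ℝ V) /
      (14 * π * Real.sqrt (finrank ℝ V) * β * dd)) * β) ≤ ‖w i ω‖} ≤ σ₁ := by
    intro i
    set T : Set (dualLattice L) := {x | K * (2 * (2 * Real.sqrt (finrank ℝ V) /
      (14 * π * Real.sqrt (finrank ℝ V) * β * dd)) * β) ≤ ‖((x : dualLattice L) : V)‖} with hT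
    have hpre : {ω : Fin N → dualLattice L | K * (2 * (2 * Real.sqrt (finrank ℝ V) /
        (14 * π * Real.sqrt (finrank ℝ V) * β * dd)) * β) ≤ ‖w i ω‖} = (fun ω => ω i) ⁻¹' T := rfl
    rw [measureReal_def, hpre, ← Measure.map_apply (measurable_pi_apply i) T.to_countable.measurableSet,
      (hlaw i).map_eq, PMF.toMeasure_apply_eq_toOuterMeasure_apply,
      toReal_toOuterMeasure_apply]
    · refine le_of_eq_of_le (tsum_congr fun x => ?_) h17
      simp only [hT, Set.indicator_apply, Set.mem_setOf_eq]
      split_ifs <;> simp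
    · exact T.to_countable.measurableSet
  have h := measureReal_verifier_reject_le_mr hind hL2 t hβ hdd hK hn h16' h18' h17'
  simp only [Fintype.card_fin] at h
  rwa [hP, measureReal_indepLaw_eq_toReal] at h

/-! ### The verdict on `N` blocks of `k` runs -/

/-- **The verifier's verdict** on `N` blockwise outcomes (MR07 p. 28: accept iff (a) `wᵢ ∈ L*` —
automatic —, (b) `N⁻¹∑ cos(2π⟨t, wᵢ⟩) < 1/2`, (c) `∑⟨x, wᵢ⟩² ≤ N‖x‖²/(2πd)²` for all `x`); every
block must have produced a witness. [cite: MicciancioRegev2007, Thm. 5.23 (the verifier V, p. 28)] -/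
def accepts (t : V) (dd : ℝ) {N : ℕ} (o : Fin N → Option (dualLattice L)) : Prop :=
  (∀ i, o i ≠ none) ∧
    (∑ i, Real.cos (2 * π * ⟪t, (((o i).getD 0 : dualLattice L) : V)⟫_ℝ)) / N < 1 / 2 ∧
    ∀ x : V, ∑ i, ⟪x, (((o i).getD 0 : dualLattice L) : V)⟫_ℝ ^ 2 ≤ N * ‖x‖ ^ 2 / (2 * π * dd) ^ 2

/-- **`N` blocks of `k` runs of `W` yield an accepted tuple except with probability
`≤ N·Pr[abort]^k + (Hoeffding + Lemma 5.20 bound)`**, whenever the conditional witness law `D`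
(`Pr[W = w] = Pr[¬abort]·D(w)`) satisfies eqs. (16)–(18).
[cite: MicciancioRegev2007, Thm. 5.23 (proof, NO case, pp. 29–31)] -/
theorem toReal_blocks_not_accepts_le (hn : 2 ≤ finrank ℝ V) (t : V) {β dd K σ₁ : ℝ} (hβ : 0 < β)
    (hdd : 0 < dd) (hK : 0 < K) (p : PMF (Option (dualLattice L))) {D : PMF (dualLattice L)}
    (hD : ∀ w, p (some w) = (1 - p none) * D w)
    (h16 : ∑' w, (D w).toReal * Real.cos (2 * π * ⟪t, ((w : dualLattice L) : V)⟫_ℝ) ≤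
      2 * (2⁻¹ : ℝ) ^ finrank ℝ V)
    (h18 : ∀ u : V, ‖u‖ = 1 → ∑' w, D w * ENNReal.ofReal (⟪u, ((w : dualLattice L) : V)⟫_ℝ ^ 2) ≤
      ENNReal.ofReal ((2 * (2 * Real.sqrt (finrank ℝ V) /
        (14 * π * Real.sqrt (finrank ℝ V) * β * dd)) * β) ^ 2))
    (h17 : ∑' w, (D w).toReal * (if K * (2 * (2 * Real.sqrt (finrank ℝ V) /
        (14 * π * Real.sqrt (finrank ℝ V) * β * dd)) * β) ≤ ‖((w : dualLattice L) : V)‖ then (1 : ℝ)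
          else 0) ≤ σ₁)
    {C : ℝ≥0∞} (hC : C ≠ ∞) (hnorm : ∑' w, D w * (‖((w : dualLattice L) : V)‖ₑ : ℝ≥0∞) ^ 2 ≤ C)
    (N k : ℕ) [NeZero N] :
    ((indepLaw N fun _ => (indepLaw k fun _ => p).map fun v => (List.ofFn v).findSome? id).toOuterMeasure
        {o | ¬ accepts L t dd o}).toReal ≤
      N * (p none ^ k).toReal +
        (Real.exp (-(N * (1 / 2 - 2 * (2⁻¹ : ℝ) ^ finrank ℝ V) ^ 2 / 2)) +
          (Real.exp (-(N / K ^ 4)) * (4 * Real.sqrt (finrank ℝ V) * K ^ 2) ^ finrank ℝ V + N * σ₁)) := by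
  refine (toReal_indepLaw_firstSuccess_le p hD N k {o | ¬ accepts L t dd o}).trans ?_
  gcongr
  have hset : {w : Fin N → dualLattice L | (fun j => some (w j)) ∈ {o : Fin N → Option (dualLattice L) |
      ¬ accepts L t dd o}} =
      {ω | ¬ ((∑ i, Real.cos (2 * π * ⟪t, ((ω i : dualLattice L) : V)⟫_ℝ)) / N < 1 / 2 ∧
        ∀ x : V, ∑ i, ⟪x, ((ω i : dualLattice L) : V)⟫_ℝ ^ 2 ≤ N * ‖x‖ ^ 2 / (2 * π * dd) ^ 2)} := by
    ext w
    simp only [accepts, Set.mem_setOf_eq, ne_eq, reduceCtorEq, not_false_eq_true, implies_true,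
      true_and, Option.getD_some]
  rw [hset]
  exact toReal_indepLaw_cond_reject_le L hn t hβ hdd hK h16 h18 h17 hC hnorm N

end Blocks

end MicciancioRegev2007

end Literature.Algebra.EuclideanLattices

end
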